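import Literature.NumberTheory.Automorphic.RankOneBorelBruhat
import Literature.NumberTheory.Automorphic.ReductiveDualRankOneProofs
import Literature.NumberTheory.Automorphic.ReductiveDualRelationsProofs
import HarnessLib

/-!
# Discharge of `exists_isRootDatumOf` (Springer 7.4.3): the root datum of a connected reductive
# group exists (trunk T-AUTOMORPHIC, G25 AutomorphicL; proof file of `ReductiveDual.lean`)

The named fact `exists_isRootDatumOf` (`ReductiveDual.lean`; Springer, *Linear Algebraic Groups*,
2nd ed., Thm. 7.4.3: "*`Ψ(G, T) = (X*(T), R, X_*(T), R^∨)` is a root datum*", with 7.4.4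
reducedness) is proved by assembling theorems of the tree:

* `exists_isRootDatumOf_of_rankOneFacts` (`ReductiveDualRankOneProofs.lean`): 7.4.3 from the two
  rank-one facts `exists_sl2Realization_of_central` (8.1.4 (i) in semisimple rank one) and
  `exists_rootHom_sup_isBorelIn_of_central` (7.3.3 (ii) with 7.3.2), the passage to
  `G_α° = Z_G((Ker α)°)°` replacing 7.6.4;
* `exists_sl2Realization_of_central_of_rootHomBorel` (`ReductiveDualRelationsProofs.lean`): the
  first rank-one fact from the second (Bruhat decomposition 7.2.2 (i), relations 7.2.4, 8.1.4);
* `exists_rootHom_sup_isBorelIn_of_central_holds` (`RankOneBorelBruhat.lean`): **7.3.3 (ii)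
  proved** (the rank-one orbit analysis for an arbitrary Borel subgroup `B ⊇ T · U_α`, Chevalley's
  theorem on the unipotent radical in Luna's form, `B = T · U_α`).

Also recorded: `exists_sl2Realization_of_central_holds` and the discharges of the intermediate
named facts `exists_sl2Realization` (8.1.4 (i)), `exists_corootMap` (7.4.3, coroots with (RD 2))
and `roots_isReduced` (7.4.4) of `ReductiveDualRootDatum.lean` / `ReductiveDualRankOne.lean`,
each a one-line application as announced in `ReductiveDualRankOneProofs.lean`.

## References

* [SpringerLAG1998] T. A. Springer, *Linear Algebraic Groups*, 2nd ed., Progress in Mathematics 9,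
  Birkhäuser (1998): 7.3.3 (ii), Thm. 7.4.3, Lemma 7.4.4, 8.1.4 (i).
-/

noncomputable section

open scoped MatrixGroups IsMulCommutative

namespace Literature.NumberTheory.Automorphic

variable {k : Type*} [Field k] {n : Type*} [Fintype n] [DecidableEq n]

/-- **Springer 8.1.4 (i) in semisimple rank one — discharge of `exists_sl2Realization_of_central`**
(from 7.3.3 (ii), `exists_sl2Realization_of_central_of_rootHomBorel`). [cite: SpringerLAG1998, 8.1.4 (i)] -/
theorem exists_sl2Realization_of_central_holds :
    exists_sl2Realization_of_central (k := k) (n := n) :=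
  exists_sl2Realization_of_central_of_rootHomBorel exists_rootHom_sup_isBorelIn_of_central_holds

variable {G T : Subgroup (GL n k)}

/-- **Springer 7.4.3 — discharge of the named fact `exists_isRootDatumOf`**: a connected reductive
group over an algebraically closed field, with a maximal torus `T`, carries a reduced root datum
realised on `(X*(T), X_*(T))`. [cite: SpringerLAG1998, Thm 7.4.3 with 7.4.4] -/
theorem exists_isRootDatumOf_holds : exists_isRootDatumOf (G := G) (T := T) :=
  exists_isRootDatumOf_of_rankOneFacts exists_sl2Realization_of_central_holds
    exists_rootHom_sup_isBorelIn_of_central_holds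

/-- **Springer 8.1.4 (i) — discharge of `exists_sl2Realization`** (`ReductiveDualRootDatum.lean`).
[cite: SpringerLAG1998, 8.1.4 (i)] -/
theorem exists_sl2Realization_holds : exists_sl2Realization (G := G) (T := T) :=
  exists_sl2Realization_of_rankOneFact exists_sl2Realization_of_central_holds

/-- **Springer 7.4.3, the coroots — discharge of `exists_corootMap`** (`ReductiveDualRootDatum.lean`).
[cite: SpringerLAG1998, Thm 7.4.3] -/
theorem exists_corootMap_holds : exists_corootMap (G := G) (T := T) :=
  exists_corootMap_of_rankOneFact exists_sl2Realization_of_central_holds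

/-- **Springer 7.4.4 — discharge of `roots_isReduced`** (`ReductiveDualRootDatum.lean`).
[cite: SpringerLAG1998, Lemma 7.4.4] -/
theorem roots_isReduced_holds : roots_isReduced (G := G) (T := T) :=
  roots_isReduced_of_rankOneBorel exists_rootHom_sup_isBorelIn_of_central_holds

end Literature.NumberTheory.Automorphic

end
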